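import Summits.QuantumFields.YangMills.Theorems.LangevinControlUVOSLegsFromFemtoAndGapStubLowerCube

/-!
# Stub `stub_lower` of line `dlr-collar-transfer` (crux `OSLegsFromFemtoAndGap`, stmt-QuantumFields-9367):
# the per-pair covariance floor from FBL + FC2

`pair_floor`: at a physical scale `s` chosen inside the growth clauses of FC2 (`Γ(t) > M t⁸` on
`(0, 3s/2)`, `4C₁²/D⁸ ≤ c₂M/2`), for every coupling `β` past the FBL/FC2 thresholds with `a(β)` small
and every torus covering the femto cube, every pair of sites `x, y` read by the reflected bump
(`a x` near `-(s/2)e₀`) and the bump (`a y` near `(s/2)e₀`) has torus covariance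
`Cov(dens x, dens y) ≥ (c₂ M / 2) a⁸`: FC2's conditional floor inside the cube of radius
`R = ⌈Q/a⌉ + 2` around `x` (`Q = K(s/2)·3s/2 + D + 3s/2`), FBL's boundary law at depth `≥ D/a`, and
the law of total covariance (`cov_pair_lower`).
-/

set_option autoImplicit false

noncomputable section

open scoped SchwartzMap
open MeasureTheory Filter Topology
open Literature.MathematicalPhysics.QuantumFieldTheory Literature.MathematicalPhysics.QuantumLattice
open Literature.MathematicalPhysics.AQFT Literature.Probability.LatticeModels
open Summit.QuantumFields.YangMills.Theorems.OSLegsFromFemtoAndGap.StubLower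

namespace Summit.QuantumFields.YangMills.Cruxes.OSLegsFromFemtoAndGap.DlrCollarTransfer.StubLower

/-- **Pair geometry.** If `a x` is within `s/4` of `-(s/2)e₀` and `a y` within `s/4` of `(s/2)e₀`
then the physical separation `‖y - x‖ a` lies in `(s/2, 3s/2)`. [folklore] -/
theorem pair_separation {s a : ℝ} (ha : 0 < a) (x y : Fin 4 → ℤ)
    (hx : ‖a • siteToE x + EuclideanSpace.single 0 (s / 2)‖ < s / 4)
    (hy : ‖a • siteToE y - EuclideanSpace.single 0 (s / 2)‖ < s / 4) :
    s / 2 < ‖siteToE (y - x)‖ * a ∧ ‖siteToE (y - x)‖ * a < 3 * s / 2 := by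
  set p₀ : EuclideanSpace ℝ (Fin 4) := EuclideanSpace.single 0 (s / 2) with hp₀
  have hs : 0 ≤ s := by linarith [norm_nonneg (a • siteToE y - p₀)]
  have key : a • siteToE (y - x) = (a • siteToE y - p₀) - (a • siteToE x + p₀) + (2 : ℝ) • p₀ := by
    rw [siteToE_sub, smul_sub, two_smul]; abel
  have hn : ‖siteToE (y - x)‖ * a = ‖a • siteToE (y - x)‖ := by
    rw [norm_smul, Real.norm_eq_abs, abs_of_pos ha, mul_comm]
  have h2p : ‖(2 : ℝ) • p₀‖ = s := by
    rw [norm_smul, hp₀, norm_single_zero, Real.norm_eq_abs, abs_of_pos two_pos,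
      abs_of_nonneg (by linarith)]
    ring
  rw [hn, key]
  constructor
  · have := norm_sub_norm_le ((2 : ℝ) • p₀) ((a • siteToE x + p₀) - (a • siteToE y - p₀))
    have e : (2 : ℝ) • p₀ - ((a • siteToE x + p₀) - (a • siteToE y - p₀)) =
        (a • siteToE y - p₀) - (a • siteToE x + p₀) + (2 : ℝ) • p₀ := by abel
    rw [e, h2p] at this
    have := norm_sub_le (a • siteToE x + p₀) (a • siteToE y - p₀)
    linarith
  · have h1 := norm_add_le ((a • siteToE y - p₀) - (a • siteToE x + p₀)) ((2 : ℝ) • p₀)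
    have h2 := norm_sub_le (a • siteToE y - p₀) (a • siteToE x + p₀)
    rw [h2p] at h1
    linarith

/-- Coordinates of `y - x` are bounded by the Euclidean lattice separation. [folklore] -/
theorem abs_sub_le_norm_siteToE (x y : Fin 4 → ℤ) (j : Fin 4) :
    |((y j : ℤ) : ℝ) - x j| ≤ ‖siteToE (y - x)‖ := by
  have := abs_apply_le_norm (siteToE (y - x)) j
  simpa [siteToE_apply] using this

/-! ### Real-arithmetic bookkeeping (kept out of the main proof's heartbeat budget) -/

/-- **Choice of the cube radius.** `R = ⌈Q/α⌉ + 2`, `Q = k·3s/2 + D + 3s/2`: the cube of radius `R`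
around `x` contains every `y` at lattice distance `ν ≤ 3s/(2α)` at depth `≥ kν`, `≥ D/α`, `≥ 2`, is
femto (`(2R+1)α ≤ 3sk + 2D + 3s + 7α`) and fits in every torus with `Q + 4α ≤ αL`. [folklore] -/
theorem cube_radius {α s k D ν : ℝ} (hα : 0 < α) (hs : 0 < s) (hk : 1 ≤ k) (hD : 0 < D)
    (hν : ν * α ≤ 3 * s / 2) {L : ℕ}
    (hL : 3 * s * k / 2 + D + 3 * s / 2 + 4 * α ≤ α * L) :
    ∃ R : ℕ, 1 ≤ R ∧ R + 1 ≤ L ∧ ν + 2 ≤ R ∧ k * ν ≤ R + 1 - ν ∧ D / α ≤ R + 1 - ν ∧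
      (2 : ℝ) ≤ R + 1 - ν ∧ (2 * R + 1) * α ≤ 3 * s * k + 2 * D + 3 * s + 7 * α := by
  set Q : ℝ := k * (3 * s / 2) + D + 3 * s / 2 with hQ
  have hQ3 : 3 * s / 2 ≤ Q := by rw [hQ]; nlinarith
  have hQ0 : 0 ≤ Q := by linarith
  obtain ⟨R, hR⟩ : ∃ R : ℕ, R = ⌈Q / α⌉₊ + 2 := ⟨_, rfl⟩
  have hRge : Q / α + 2 ≤ (R : ℝ) := by
    rw [hR]; push_cast; linarith [Nat.le_ceil (Q / α)]
  have hRle : (R : ℝ) ≤ Q / α + 3 := by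
    rw [hR]; push_cast
    linarith [(Nat.ceil_lt_add_one (by positivity : 0 ≤ Q / α)).le]
  have hν3 : ν ≤ 3 * s / 2 / α := by rw [le_div_iff₀ hα]; exact hν
  have hνQ : ν ≤ Q / α := hν3.trans (div_le_div_of_nonneg_right hQ3 hα.le)
  have hsplit : (k * (3 * s / 2) + D) / α = Q / α - 3 * s / 2 / α := by
    rw [hQ]; field_simp; ring
  have hP : (k * (3 * s / 2) + D) / α + 3 ≤ (R : ℝ) + 1 - ν := by rw [hsplit]; linarith
  refine ⟨R, by rw [hR]; omega, ?_, by linarith, ?_, ?_, ?_, ?_⟩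
  · have h1 : Q / α ≤ L - 4 := by
      rw [div_le_iff₀ hα]
      have : Q = 3 * s * k / 2 + D + 3 * s / 2 := by rw [hQ]; ring
      nlinarith
    have : (R : ℝ) + 1 ≤ L := by linarith
    exact_mod_cast this
  · have h1 : k * ν ≤ k * (3 * s / 2 / α) := mul_le_mul_of_nonneg_left hν3 (by linarith)
    have h2 : k * (3 * s / 2 / α) ≤ (k * (3 * s / 2) + D) / α := by
      rw [← mul_div_assoc]; exact div_le_div_of_nonneg_right (by linarith) hα.le
    linarith
  · have : D / α ≤ (k * (3 * s / 2) + D) / α :=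
      div_le_div_of_nonneg_right (by nlinarith) hα.le
    linarith
  · have : 0 ≤ (k * (3 * s / 2) + D) / α := div_nonneg (by nlinarith) hα.le
    linarith
  · have h1 : (2 * (R : ℝ) + 1) * α ≤ (2 * (Q / α + 3) + 1) * α :=
      mul_le_mul_of_nonneg_right (by linarith) hα.le
    have h2 : (2 * (Q / α + 3) + 1) * α = 3 * s * k + 2 * D + 3 * s + 7 * α := by
      rw [hQ]; field_simp; ring
    linarith

/-- FC2's sandwich at a scale where `Γ(t) > M t⁸` gives the floor `c₂ M α⁸` on the conditional
covariance `κ`. [folklore] -/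
theorem floor_of_shape {c₂ M ν α Γv κ : ℝ} (hc₂ : 0 < c₂) (hν : 0 < ν) (hα : 0 < α)
    (hΓ : M < Γv / (ν * α) ^ 8) (hlow : c₂ * Γv ≤ ν ^ 8 * κ) : c₂ * M * α ^ 8 ≤ κ := by
  rw [lt_div_iff₀ (by positivity)] at hΓ
  have h1 : c₂ * (M * (ν * α) ^ 8) ≤ c₂ * Γv := mul_le_mul_of_nonneg_left hΓ.le hc₂.le
  have h2 : ν ^ 8 * (c₂ * M * α ^ 8) ≤ ν ^ 8 * κ :=
    calc ν ^ 8 * (c₂ * M * α ^ 8) = c₂ * (M * (ν * α) ^ 8) := by ring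
      _ ≤ _ := h1.trans hlow
  exact le_of_mul_le_mul_left h2 (by positivity)

/-- FBL's `C₁/d⁴` at depth `d ≥ D/α` is at most `C₁ (α/D)⁴`. [folklore] -/
theorem boundary_of_depth {C₁ D α d e : ℝ} (hC₁ : 0 ≤ C₁) (hD : 0 < D) (hα : 0 < α) (hd : 0 < d)
    (hDd : D / α ≤ d) (he : e ≤ C₁ / d ^ 4) : e ≤ C₁ * (α / D) ^ 4 := by
  refine he.trans ?_
  rw [div_eq_mul_inv, ← inv_pow]
  refine mul_le_mul_of_nonneg_left (pow_le_pow_left₀ (inv_nonneg.2 hd.le) ?_ 4) hC₁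
  rw [inv_le_comm₀ hd (by positivity), inv_div]
  exact hDd

/-- Signal minus boundary: `c₂Mα⁸ - 4(C₁(α/D)⁴)² ≥ (c₂M/2)α⁸` once `4C₁²/D⁸ ≤ c₂M/2`. [folklore] -/
theorem half_signal {c₂ M C₁ D α cov : ℝ} (hD : 0 < D) (hα : 0 < α)
    (hMC : 4 * C₁ ^ 2 / D ^ 8 ≤ c₂ * M / 2)
    (hcov : c₂ * M * α ^ 8 - 4 * (C₁ * (α / D) ^ 4) * (C₁ * (α / D) ^ 4) ≤ cov) :
    c₂ * M / 2 * α ^ 8 ≤ cov := by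
  have hD0 : D ≠ 0 := hD.ne'
  have e : 4 * (C₁ * (α / D) ^ 4) * (C₁ * (α / D) ^ 4) = (4 * C₁ ^ 2 / D ^ 8) * α ^ 8 := by
    field_simp
  have : (4 * C₁ ^ 2 / D ^ 8) * α ^ 8 ≤ (c₂ * M / 2) * α ^ 8 :=
    mul_le_mul_of_nonneg_right hMC (by positivity)
  linarith

section PairFloor

variable (G : Type) [Group G] [TopologicalSpace G] [IsTopologicalGroup G] [CompactSpace G]
  [MeasurableSpace G] [BorelSpace G] (r : LatticeRep G) (a : ℝ → ℝ)

/-- **The per-pair covariance floor.** See the module docstring. [folklore] -/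
theorem pair_floor
    {C₁ β₁ ℓ₁ : ℝ} {p : ℝ → ℝ} (hC₁ : 0 ≤ C₁)
    (hFBL : ∀ β : ℝ, β₁ ≤ β → ∀ (c : Fin 4 → ℤ) (b : ℕ), (b : ℝ) * a β ≤ ℓ₁ →
      ∀ (η : LGConfig 4 G) (x : Fin 4 → ℤ), 2 ≤ depth c b x →
        |kerE G r β c b η (dens G r x) - p β| ≤ C₁ / (depth c b x : ℝ) ^ 4)
    {Γ : ℝ → ℝ} {β₂ ℓ₂ c₂ C₂ : ℝ} {K : ℝ → ℝ} {n₀ : ℕ} (hc₂ : 0 < c₂) (hK1 : ∀ s, 1 ≤ K s)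
    (hFC2 : ∀ β : ℝ, β₂ ≤ β → ∀ (c : Fin 4 → ℤ) (b : ℕ), (b : ℝ) * a β ≤ ℓ₂ →
      ∀ (η : LGConfig 4 G) (x y : Fin 4 → ℤ) (s₀ : ℝ), 0 < s₀ → s₀ ≤ ‖siteToE (y - x)‖ * a β →
        (n₀ : ℝ) ≤ ‖siteToE (y - x)‖ → K s₀ * ‖siteToE (y - x)‖ ≤ depth c b x →
          K s₀ * ‖siteToE (y - x)‖ ≤ depth c b y →
            c₂ * Γ (‖siteToE (y - x)‖ * a β) ≤
                ‖siteToE (y - x)‖ ^ 8 * kerCov G r β c b η (dens G r x) (dens G r y) ∧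
              ‖siteToE (y - x)‖ ^ 8 * kerCov G r β c b η (dens G r x) (dens G r y) ≤
                C₂ * Γ (‖siteToE (y - x)‖ * a β))
    {s D M δ₂ : ℝ} (hs : 0 < s) (hD : 0 < D)
    (hΓM : ∀ t : ℝ, 0 < t → t < δ₂ → M < Γ t / t ^ 8) (hsδ₂ : 3 * s / 2 < δ₂)
    (hMC : 4 * C₁ ^ 2 / D ^ 8 ≤ c₂ * M / 2)
    {β : ℝ} (hβ₁ : β₁ ≤ β) (hβ₂ : β₂ ≤ β) (hα : 0 < a β) (hαn₀ : (n₀ : ℝ) * a β ≤ s / 2)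
    (hfem₁ : 3 * s * K (s / 2) + 2 * D + 3 * s + 7 * a β ≤ ℓ₁)
    (hfem₂ : 3 * s * K (s / 2) + 2 * D + 3 * s + 7 * a β ≤ ℓ₂)
    {L : ℕ} (hL : 3 * s * K (s / 2) / 2 + D + 3 * s / 2 + 4 * a β ≤ a β * L)
    (x y : Fin 4 → ℤ) (hx : ‖a β • siteToE x + EuclideanSpace.single 0 (s / 2)‖ < s / 4)
    (hy : ‖a β • siteToE y - EuclideanSpace.single 0 (s / 2)‖ < s / 4) :
    c₂ * M / 2 * a β ^ 8 ≤ torusE G r β L (fun U => dens G r x U * dens G r y U)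
      - torusE G r β L (dens G r x) * torusE G r β L (dens G r y) := by
  obtain ⟨hν1, hν2⟩ := pair_separation hα x y hx hy
  have hν0 : 0 < ‖siteToE (y - x)‖ := by
    by_contra h
    push Not at h
    nlinarith
  -- the cube of radius `R` around `x`
  obtain ⟨R, hR1, hRL, hνR, hKν, hDa, h2, hfem⟩ :=
    cube_radius (ν := ‖siteToE (y - x)‖) hα hs (hK1 (s / 2)) hD hν2.le hL
  have hyx : ∀ j, |y j - x j| + 1 ≤ (R : ℤ) := fun j => by
    have h1 := abs_sub_le_norm_siteToE x y j
    have h3 : ((|y j - x j| + 1 : ℤ) : ℝ) ≤ R := by push_cast; linarith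
    exact_mod_cast h3
  -- depths of `x` and `y`
  have hdx : (R : ℝ) + 1 - ‖siteToE (y - x)‖ ≤ (depth (fun j => x j - R) (2 * R + 1) x : ℝ) := by
    have := le_depth_cube x x R (t := 0) (fun j => by simp)
    linarith
  have hdy : (R : ℝ) + 1 - ‖siteToE (y - x)‖ ≤ (depth (fun j => x j - R) (2 * R + 1) y : ℝ) :=
    le_depth_cube x y R fun j => abs_sub_le_norm_siteToE x y j
  -- the cube is femto
  have hb : ((2 * R + 1 : ℕ) : ℝ) * a β ≤ 3 * s * K (s / 2) + 2 * D + 3 * s + 7 * a β := by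
    push_cast; exact hfem
  -- FC2: the conditional covariance floor, every exterior
  have hn₀ν : (n₀ : ℝ) ≤ ‖siteToE (y - x)‖ :=
    le_of_mul_le_mul_right (by linarith) hα
  have hs2 : (0 : ℝ) < s / 2 := by linarith
  have hfloor : ∀ η, c₂ * M * a β ^ 8 ≤
      kerCov G r β (fun j => x j - R) (2 * R + 1) η (dens G r x) (dens G r y) := fun η => by
    obtain ⟨hlow, -⟩ := hFC2 β hβ₂ (fun j => x j - R) (2 * R + 1) (hb.trans hfem₂) η x y (s / 2)
      hs2 hν1.le hn₀ν (hKν.trans hdx) (hKν.trans hdy)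
    exact floor_of_shape hc₂ hν0 hα (hΓM _ (by positivity) (by linarith)) hlow
  -- FBL: the boundary law at depth `≥ D/α`
  have hh : ∀ z : Fin 4 → ℤ,
      (R : ℝ) + 1 - ‖siteToE (y - x)‖ ≤ (depth (fun j => x j - R) (2 * R + 1) z : ℝ) →
      ∀ η, |kerE G r β (fun j => x j - R) (2 * R + 1) η (dens G r z) - p β| ≤
        C₁ * (a β / D) ^ 4 := by
    intro z hz η
    have h2z : 2 ≤ depth (fun j => x j - R) (2 * R + 1) z := by
      have : (2 : ℝ) ≤ depth (fun j => x j - R) (2 * R + 1) z := h2.trans hz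
      exact_mod_cast this
    exact boundary_of_depth hC₁ hD hα (by linarith) (hDa.trans hz)
      (hFBL β hβ₁ _ _ (hb.trans hfem₁) η z h2z)
  -- law of total covariance
  exact half_signal hD hα hMC
    (cov_pair_lower G r β x y R L hRL hR1 hyx (hh x hdx) (hh y hdy) hfloor)

end PairFloor

end Summit.QuantumFields.YangMills.Cruxes.OSLegsFromFemtoAndGap.DlrCollarTransfer.StubLower

end
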